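import Mathlib
import HarnessLib

/-!
# Route `TropicalWeilObstruction` (Kontsevich's tropical test — NEGATION SINK, exploration, no summit claim):
# uniform lifts kill the Weil functional — the character identity behind the sheets of the tropical Schoen cycle

Negation-sink bookkeeping of the cell `pub-hodge-tropical` (seat tropical-2 gen 34; algebraic core of HOME
`certificates/schoen3-t2/README.md` §2(a), the independent engine for the tropical Schoen cycle, and of the sheet structure used by
`certificates/schoenK4/`, tropical-1 gen 26).

Setting (docstring level; nothing of it is formalised here). Let `Γ → Γ'` be a ℤ/4 étale cover of metric graphs with Weil lattice
`Λ ≅ ℤ[i]ⁿ`, and let a top cell `σ` of a weighted polyhedral `n`-complex of effective divisors of degree `d` on `Γ'` have chips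
`j ∈ ι` (`|ι| = d`) moving with integer velocity matrix `B` (`d × n`). A lift of the cell chooses a sheet `k_j ∈ ℤ/4` for every chip; its
Abel–Prym image in the tropical Weil torus `ℝ²ⁿ/Π` has complex frame determinant
`η_k = det_ℂ(Σ_j i^{k_j} d_j ⊗ b_j) = Σ_{|T| = n} i^{Σ_{j∈T} k_j} · D_T`, `D_T = det_ℂ(d_T)·det(B_T)` (Cauchy–Binet), and contributes
`w·V·η_k²` to the Weil functional `W = Σ w a η²` of the tree (`Literature.AlgebraicGeometry.Tropical.weilFunctional`). This file proves the
finite identity that makes the FULL norm-preimage useless and forces Schoen's construction onto ONE sheet of `Nm⁻¹` of a linear system: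

* `prod_I_pow_add_single`: the lift character `χ_k(T) = ∏_{j∈T} I^{k_j}` (written out as a product; no definition is introduced)
  gets multiplied by `I` exactly when the shifted chip `j₀` lies in `T`;
* `sum_prod_I_pow_mul_eq_zero`: **`Σ_{k : ι → ℤ/4} χ_k(T) χ_k(T') = 0` whenever `T ∪ T' ≠ ∅`** (the sum is invariant under the shift at
  some `j₀ ∈ T ∪ T'`, which multiplies it by `I` or `I² = −1 ≠ 1`);
* **`sum_sq_over_all_lifts_eq_zero`**: for every coefficient system `D : Finset ι → ℂ` with `D ∅ = 0`,
  `Σ_{k : ι → ℤ/4} (Σ_T χ_k(T) · D_T)² = 0` — summed over ALL `4^d` lifts of a cell, the squares of the frame determinants cancel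
  exactly, for every cell, whatever the complex upstairs. Consequences recorded in the HOME READMEs: the full preimage `AP_*Ñ⁻¹(F)` of ANY
  tropical complex `F ⊂ Sym^d(Γ')` has `W = 0` (this contains the cell's class-level no-go for Pontryagin products of the Abel–Prym curve);
  `W ≠ 0` needs a sub-family of lifts closed under continuation — the four sheets of `Nm⁻¹|D|` for `D` in ONE linear system (Abel's
  theorem) — and then survives only for `d = 2n` chips (the canonical `g^{n}_{2n}`: `g²₄` on genus 3, `g³₆` on genus 4), with
  `W(sheet c) = 4^{d−1} i^c Σ_T D_T D_{Tᶜ}` (the sheet version is not formalised here).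

HONEST STATUS. A finite algebraic identity over `ℂ` (characters of `(ℤ/4)^d`), kernel-checked for every finite index type; its tropical
meaning is docstring-level. Decides nothing about K1 (`TropicalWeilVanishing`, `n = 4`, OPEN), K1_∂, K2, the typed `n = 3` calibration
(`PrymThree.TropicalSchoenCalibrationThree`, settled the same day by two exact engines OUTSIDE the kernel) or the Hodge conjecture.
Mathlib + HarnessLib only; no definition (the character is written out as a product), no named-fact hypothesis, no sorry.
References: [Zharkov2020TropicalWeil] I. Zharkov, arXiv:2002.02347, §2 (pp. 2–4); C. Schoen, Compositio Math. 65 (1988), §1;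
[MikhalkinZharkov2014Eigenwave] G. Mikhalkin, I. Zharkov, LN UMI 15 (2014), Prop. 4.3.
-/

set_option linter.dupNamespace false

noncomputable section

open scoped BigOperators
open Finset

namespace Summit.HodgeConjecture.HodgeConjecture.Theorems.TropicalWeilVanishing

namespace LiftCharacters

variable {ι : Type*} [DecidableEq ι]

/-- Raising a sheet by one step multiplies `I^{k}` by `I` (including the wrap-around `3 ↦ 0`, since `I⁴ = 1`). [folklore] -/
theorem I_pow_fin_add_one (a : Fin 4) :
    Complex.I ^ ((a + 1 : Fin 4) : ℕ) = Complex.I * Complex.I ^ ((a : Fin 4) : ℕ) := by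
  fin_cases a
  · simp
  · simp [pow_succ]
  · simp [pow_succ]
  · show Complex.I ^ (((3 : Fin 4) + 1 : Fin 4) : ℕ) = Complex.I * Complex.I ^ 3
    have h4 : (((3 : Fin 4) + 1 : Fin 4) : ℕ) = 0 := by decide
    rw [h4, pow_zero, ← pow_succ', Complex.I_pow_four]

/-- **Shift rule.** The lift character `χ_k(T) = ∏_{j∈T} I^{k_j}` of a chip set `T` at the sheet vector `k : ι → ℤ/4` — the phase
the lift `k` puts in front of the Cauchy–Binet coefficient `D_T` of the lifted cell's complex frame determinant — is multiplied by `I`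
under the shift of the single chip `j₀` (`k ↦ k + δ_{j₀}`) if `j₀ ∈ T`, and is unchanged otherwise. [folklore] -/
theorem prod_I_pow_add_single (k : ι → Fin 4) (T : Finset ι) (j₀ : ι) :
    (∏ j ∈ T, Complex.I ^ (((k + Pi.single j₀ 1 : ι → Fin 4) j : Fin 4) : ℕ)) =
      (if j₀ ∈ T then Complex.I else 1) * ∏ j ∈ T, Complex.I ^ ((k j : Fin 4) : ℕ) := by
  by_cases hj : j₀ ∈ T
  · rw [if_pos hj, ← Finset.mul_prod_erase T _ hj, ← Finset.mul_prod_erase T (fun j => Complex.I ^ ((k j : Fin 4) : ℕ)) hj]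
    have h0 : (k + Pi.single j₀ (1 : Fin 4) : ι → Fin 4) j₀ = k j₀ + 1 := by simp
    rw [h0, I_pow_fin_add_one, mul_assoc]
    congr 1
    congr 1
    refine Finset.prod_congr rfl fun j hjT => ?_
    have hne : j ≠ j₀ := Finset.ne_of_mem_erase hjT
    simp [hne]
  · rw [if_neg hj, one_mul]
    refine Finset.prod_congr rfl fun j hjT => ?_
    have hne : j ≠ j₀ := fun h => hj (h ▸ hjT)
    simp [hne]

/-- **Orthogonality: uniform lifts cancel every mixed character.** If `T ∪ T'` is non-empty then
`Σ_{k : ι → ℤ/4} χ_k(T)·χ_k(T') = 0`: the sum is invariant under the shift at a chip `j₀ ∈ T ∪ T'`, which multiplies every term by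
`I` (if `j₀` lies in exactly one of `T, T'`) or by `I² = −1` (if in both) — never by `1`. [folklore] -/
theorem sum_prod_I_pow_mul_eq_zero [Fintype ι] (T T' : Finset ι) (h : (T ∪ T').Nonempty) :
    ∑ k : ι → Fin 4, (∏ j ∈ T, Complex.I ^ ((k j : Fin 4) : ℕ)) * (∏ j ∈ T', Complex.I ^ ((k j : Fin 4) : ℕ)) = 0 := by
  set chi : (ι → Fin 4) → Finset ι → ℂ := fun k U => ∏ j ∈ U, Complex.I ^ ((k j : Fin 4) : ℕ) with hchi
  have chi_add_single : ∀ (k : ι → Fin 4) (U : Finset ι) (j₀ : ι),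
      chi (k + Pi.single j₀ 1) U = (if j₀ ∈ U then Complex.I else 1) * chi k U :=
    fun k U j₀ => prod_I_pow_add_single k U j₀
  show ∑ k : ι → Fin 4, chi k T * chi k T' = 0
  obtain ⟨j₀, hj₀⟩ := h
  set c : ℂ := (if j₀ ∈ T then Complex.I else 1) * (if j₀ ∈ T' then Complex.I else 1) with hc
  have hc1 : c ≠ 1 := by
    rcases Finset.mem_union.1 hj₀ with h1 | h2
    · by_cases h2 : j₀ ∈ T'
      · rw [hc, if_pos h1, if_pos h2, Complex.I_mul_I]; norm_num
      · rw [hc, if_pos h1, if_neg h2, mul_one]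
        intro hI
        have := congrArg Complex.im hI
        simp at this
    · by_cases h1 : j₀ ∈ T
      · rw [hc, if_pos h1, if_pos h2, Complex.I_mul_I]; norm_num
      · rw [hc, if_neg h1, if_pos h2, one_mul]
        intro hI
        have := congrArg Complex.im hI
        simp at this
  set S : ℂ := ∑ k : ι → Fin 4, chi k T * chi k T' with hS
  -- invariance of the sum under the shift `k ↦ k + δ_{j₀}`
  have hshift : S = c * S := by
    calc S = ∑ k : ι → Fin 4, chi (k + Pi.single j₀ (1 : Fin 4)) T * chi (k + Pi.single j₀ (1 : Fin 4)) T' := by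
          rw [hS]
          exact (Equiv.sum_comp (Equiv.addRight (Pi.single j₀ (1 : Fin 4))) (fun k => chi k T * chi k T')).symm
      _ = ∑ k : ι → Fin 4, c * (chi k T * chi k T') := by
          refine Finset.sum_congr rfl fun k _ => ?_
          rw [chi_add_single, chi_add_single, hc]
          ring
      _ = c * S := by rw [hS, Finset.mul_sum]
  have h0 : (1 - c) * S = 0 := by linear_combination hshift
  rcases mul_eq_zero.1 h0 with h1 | h2
  · exact absurd (sub_eq_zero.1 h1).symm hc1
  · exact h2

/-- **Uniform lifts kill the Weil functional.** For every coefficient system `D` on the chip subsets with `D ∅ = 0` (e.g. the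
Cauchy–Binet coefficients `D_T = det_ℂ(d_T)·det(B_T)`, supported on `|T| = n ≥ 1`), the squares of the lifted frame determinants
`η_k = Σ_T χ_k(T) D_T` sum to ZERO over all `4^{|ι|}` sheet vectors: `Σ_{k : ι → ℤ/4} (Σ_T χ_k(T) D_T)² = 0`. Hence the full
norm-preimage of any tropical complex of degree-`d` divisors under a ℤ/4 cover pushes forward to a cycle with `W = 0` on the tropical Weil
torus; a non-zero Weil functional needs a proper, continuation-closed family of lifts — one sheet of `Nm⁻¹` of a linear system, as in
Schoen's cycle (HOME `certificates/schoen3-t2/` §2, `certificates/schoenK4/`). [cite: Zharkov2020TropicalWeil, §2 (pp. 2–4)] -/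
theorem sum_sq_over_all_lifts_eq_zero [Fintype ι] (D : Finset ι → ℂ) (hD : D ∅ = 0) :
    ∑ k : ι → Fin 4, (∑ T : Finset ι, (∏ j ∈ T, Complex.I ^ ((k j : Fin 4) : ℕ)) * D T) ^ 2 = 0 := by
  set chi : (ι → Fin 4) → Finset ι → ℂ := fun k U => ∏ j ∈ U, Complex.I ^ ((k j : Fin 4) : ℕ) with hchi
  show ∑ k : ι → Fin 4, (∑ T : Finset ι, chi k T * D T) ^ 2 = 0
  have expand : ∀ k : ι → Fin 4, (∑ T : Finset ι, chi k T * D T) ^ 2 =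
      ∑ T : Finset ι, ∑ T' : Finset ι, D T * D T' * (chi k T * chi k T') := by
    intro k
    rw [sq, Finset.sum_mul_sum]
    refine Finset.sum_congr rfl fun T _ => Finset.sum_congr rfl fun T' _ => by ring
  simp_rw [expand]
  rw [Finset.sum_comm]
  refine Finset.sum_eq_zero fun T _ => ?_
  rw [Finset.sum_comm]
  refine Finset.sum_eq_zero fun T' _ => ?_
  rw [← Finset.mul_sum]
  by_cases h : (T ∪ T').Nonempty
  · rw [show (∑ k : ι → Fin 4, chi k T * chi k T') = 0 from sum_prod_I_pow_mul_eq_zero T T' h, mul_zero]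
  · rw [Finset.not_nonempty_iff_eq_empty, Finset.union_eq_empty] at h
    rw [h.1, hD, zero_mul, zero_mul]

end LiftCharacters

end Summit.HodgeConjecture.HodgeConjecture.Theorems.TropicalWeilVanishing

end
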